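import Literature.Analysis.Calculus.AnalyticRootFunctionsReal
import Literature.Analysis.Calculus.MonomialUnits
import Mathlib.Data.Finset.Fold
import HarnessLib

/-!
# Jung's projection method: wall differences and imaginary parts as monomials times units

Let root functions `ζ_1, …, ζ_n` be analytic on a box `B = (−δ, 1+δ)ᵈ`, with conjugation acting by
an involution `τ` (`conj ∘ ζ_l = ζ_{τ l}` on `B`), real walls `ζ_{r m}` increasing in `m` over the
open unit cube, and with discriminant product in pure-monomial form
`∏_{l ≠ l'} (ζ_l − ζ_{l'}) = σ^α · E(σ)` on `B` (`E` analytic, nowhere zero). ASSUMING the divisor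
lemma for normal-crossing monomials (hypothesis `hDIV`, verbatim from the cube-monomialisation
skeleton: a factor of `σ^α ·` unit near the closed cube is itself `σ^β ·` unit), every difference of
two walls is `σ^β` times a POSITIVE real-analytic unit and every imaginary part of a non-real root
function is `σ^β` times a nowhere vanishing real-analytic function, uniformly on a smaller box
(`exists_root_differences`). This is the input shape of the binomial normal form of the factors
`t − ζ_l` along slab charts (namespace `Literature.NumberTheory.Transcendental.JungPreparation`).

## References

* E. Bierstone, P. Milman, Publ. Math. IHÉS 67 (1988), §4; J. Kollár, *Lectures on Resolution of
  Singularities* (2007), §2.3.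
-/

noncomputable section

open Set
open scoped ComplexConjugate
open Literature.Analysis.Calculus

namespace Literature.NumberTheory.Transcendental.JungPreparation

variable {d : ℕ}

/-- Splitting the discriminant product at one ordered pair `(l, l')`. [folklore] -/
theorem prod_prod_erase_eq_mul {n : ℕ} (z : Fin n → ℂ) {l l' : Fin n} (hll' : l ≠ l') :
    ∏ l₁, ∏ l₂ ∈ Finset.univ.erase l₁, (z l₁ - z l₂) =
      (z l - z l') * ((∏ l₂ ∈ (Finset.univ.erase l).erase l', (z l - z l₂)) *
        ∏ l₁ ∈ Finset.univ.erase l, ∏ l₂ ∈ Finset.univ.erase l₁, (z l₁ - z l₂)) := by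
  classical
  rw [← Finset.mul_prod_erase _ _ (Finset.mem_univ l), ← Finset.mul_prod_erase _ _
    (Finset.mem_erase.2 ⟨Ne.symm hll', Finset.mem_univ l'⟩)]
  ring

/-- **Wall differences and imaginary parts are monomials times units.** See the module
docstring (Bierstone–Milman 1988, §4; Kollár 2007, §2.3; the divisor lemma is the hypothesis
`hDIV`). [folklore] -/
theorem exists_root_differences
    (hDIV : ∀ (U : Set (Fin d → ℝ)), IsOpen U → Set.pi Set.univ (fun _ : Fin d => Set.Icc (0:ℝ) 1) ⊆ U →
      ∀ (f g e : (Fin d → ℝ) → ℂ) (a : Fin d → ℕ), AnalyticOnNhd ℝ f U → AnalyticOnNhd ℝ g U →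
      AnalyticOnNhd ℝ e U → (∀ x ∈ U, e x ≠ 0) →
      (∀ x ∈ U, f x * g x = (∏ i, ((x i : ℝ) : ℂ) ^ a i) * e x) →
      ∃ (b : Fin d → ℕ) (V : Set (Fin d → ℝ)) (u : (Fin d → ℝ) → ℂ), IsOpen V ∧
        Set.pi Set.univ (fun _ : Fin d => Set.Icc (0:ℝ) 1) ⊆ V ∧ V ⊆ U ∧ AnalyticOnNhd ℝ u V ∧
        (∀ x ∈ V, u x ≠ 0) ∧ (∀ i, b i ≤ a i) ∧ ∀ x ∈ V, f x = (∏ i, ((x i : ℝ) : ℂ) ^ b i) * u x)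
    {n : ℕ} {δ : ℝ} (hδ : 0 < δ) (ζ : Fin n → (Fin d → ℝ) → ℂ)
    (hζa : ∀ l, AnalyticOnNhd ℝ (ζ l) (Set.pi Set.univ (fun _ : Fin d => Ioo (-δ) (1 + δ))))
    {τ : Fin n → Fin n}
    (hτ : ∀ l, ∀ σ ∈ Set.pi Set.univ (fun _ : Fin d => Ioo (-δ) (1 + δ)), conj (ζ l σ) = ζ (τ l) σ)
    {p : ℕ} {r : Fin p → Fin n} (hrinj : Function.Injective r) (hrfix : ∀ m, τ (r m) = r m)
    (hmono : ∀ σ ∈ Set.pi Set.univ (fun _ : Fin d => Ioo (0 : ℝ) 1), StrictMono fun m => (ζ (r m) σ).re)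
    {α : Fin d → ℕ} {E : (Fin d → ℝ) → ℂ}
    (hEa : AnalyticOnNhd ℝ E (Set.pi Set.univ (fun _ : Fin d => Ioo (-δ) (1 + δ))))
    (hE0 : ∀ σ ∈ Set.pi Set.univ (fun _ : Fin d => Ioo (-δ) (1 + δ)), E σ ≠ 0)
    (hdisc : ∀ σ ∈ Set.pi Set.univ (fun _ : Fin d => Ioo (-δ) (1 + δ)),
      ∏ l, ∏ l' ∈ Finset.univ.erase l, (ζ l σ - ζ l' σ) = (∏ i, ((σ i : ℝ) : ℂ) ^ α i) * E σ) :
    ∃ δ' : ℝ, 0 < δ' ∧ δ' ≤ δ ∧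
      (∀ m m' : Fin p, m < m' → ∃ (β : Fin d → ℕ) (u : (Fin d → ℝ) → ℝ),
        AnalyticOnNhd ℝ u (Set.pi Set.univ (fun _ : Fin d => Ioo (-δ') (1 + δ'))) ∧
        (∀ σ ∈ Set.pi Set.univ (fun _ : Fin d => Ioo (-δ') (1 + δ')), 0 < u σ) ∧
        ∀ σ ∈ Set.pi Set.univ (fun _ : Fin d => Ioo (-δ') (1 + δ')),
          (ζ (r m') σ).re - (ζ (r m) σ).re = (∏ i, σ i ^ β i) * u σ) ∧
      (∀ l, τ l ≠ l → ∃ (β : Fin d → ℕ) (v : (Fin d → ℝ) → ℝ),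
        AnalyticOnNhd ℝ v (Set.pi Set.univ (fun _ : Fin d => Ioo (-δ') (1 + δ'))) ∧
        (∀ σ ∈ Set.pi Set.univ (fun _ : Fin d => Ioo (-δ') (1 + δ')), v σ ≠ 0) ∧
        ∀ σ ∈ Set.pi Set.univ (fun _ : Fin d => Ioo (-δ') (1 + δ')),
          (ζ l σ).im = (∏ i, σ i ^ β i) * v σ) := by
  classical
  set Bx := Set.pi Set.univ (fun _ : Fin d => Ioo (-δ) (1 + δ)) with hBx
  have hBo : IsOpen Bx := isOpen_set_pi finite_univ fun _ _ => isOpen_Ioo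
  have hcubeB : Set.pi Set.univ (fun _ : Fin d => Icc (0 : ℝ) 1) ⊆ Bx := pi_Icc_subset_box hδ
  -- ### the divisor lemma for every ordered pair
  have hpair : ∀ pr : {pr : Fin n × Fin n // pr.1 ≠ pr.2}, ∃ (β : Fin d → ℕ) (δ₁ : ℝ) (u : (Fin d → ℝ) → ℂ),
      0 < δ₁ ∧ δ₁ ≤ δ ∧ AnalyticOnNhd ℝ u (Set.pi Set.univ (fun _ : Fin d => Ioo (-δ₁) (1 + δ₁))) ∧
      (∀ σ ∈ Set.pi Set.univ (fun _ : Fin d => Ioo (-δ₁) (1 + δ₁)), u σ ≠ 0) ∧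
      ∀ σ ∈ Set.pi Set.univ (fun _ : Fin d => Ioo (-δ₁) (1 + δ₁)),
        ζ pr.1.1 σ - ζ pr.1.2 σ = (∏ i, ((σ i : ℝ) : ℂ) ^ β i) * u σ := by
    rintro ⟨⟨l, l'⟩, hll'⟩
    simp only at hll' ⊢
    set g : (Fin d → ℝ) → ℂ := fun σ => (∏ l₂ ∈ (Finset.univ.erase l).erase l', (ζ l σ - ζ l₂ σ)) *
      ∏ l₁ ∈ Finset.univ.erase l, ∏ l₂ ∈ Finset.univ.erase l₁, (ζ l₁ σ - ζ l₂ σ) with hg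
    have hfa : AnalyticOnNhd ℝ (fun σ => ζ l σ - ζ l' σ) Bx := (hζa l).sub (hζa l')
    have hga : AnalyticOnNhd ℝ g Bx := fun σ hσ => by
      refine AnalyticAt.mul (Finset.analyticAt_fun_prod _ fun l₂ _ => (hζa l σ hσ).sub (hζa l₂ σ hσ))
        (Finset.analyticAt_fun_prod _ fun l₁ _ => Finset.analyticAt_fun_prod _ fun l₂ _ =>
          (hζa l₁ σ hσ).sub (hζa l₂ σ hσ))
    obtain ⟨β, V, u, hVo, hcubeV, hVB, hua, hu0, -, hfu⟩ := hDIV Bx hBo hcubeB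
      (fun σ => ζ l σ - ζ l' σ) g E α hfa hga hEa hE0 (fun σ hσ => by
        rw [← hdisc σ hσ, prod_prod_erase_eq_mul (fun l => ζ l σ) hll'])
    obtain ⟨δ₁, hδ₁, hboxV⟩ := exists_box_subset hVo hcubeV
    refine ⟨β, min δ₁ δ, u, lt_min hδ₁ hδ, min_le_right _ _, hua.mono ?_, fun σ hσ => hu0 σ ?_,
      fun σ hσ => hfu σ ?_⟩
    all_goals first
      | exact (Set.pi_mono fun _ _ => Ioo_subset_Ioo (by simp) (by simp)).trans hboxV
      | exact hboxV (Set.pi_mono (fun _ _ => Ioo_subset_Ioo (by simp) (by simp)) hσ)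
  choose β δ₁ u hδ₁ hδ₁δ hua hu0 hfu using hpair
  -- ### a common box
  set δ' : ℝ := (Finset.univ : Finset {pr : Fin n × Fin n // pr.1 ≠ pr.2}).fold min δ δ₁ with hδ'
  have hδ'pos : 0 < δ' := (Finset.lt_fold_min 0).2 ⟨hδ, fun pr _ => hδ₁ pr⟩
  have hδ'le : δ' ≤ δ := (Finset.fold_min_le δ).2 (Or.inl le_rfl)
  have hδ'le₁ : ∀ pr, δ' ≤ δ₁ pr := fun pr =>
    (Finset.fold_min_le (δ₁ pr)).2 (Or.inr ⟨pr, Finset.mem_univ _, le_rfl⟩)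
  set B' := Set.pi Set.univ (fun _ : Fin d => Ioo (-δ') (1 + δ')) with hB'
  have hB'sub : ∀ pr, B' ⊆ Set.pi Set.univ (fun _ : Fin d => Ioo (-(δ₁ pr)) (1 + δ₁ pr)) := fun pr =>
    Set.pi_mono fun _ _ => Ioo_subset_Ioo (by linarith [hδ'le₁ pr]) (by linarith [hδ'le₁ pr])
  have hB'B : B' ⊆ Bx := Set.pi_mono fun _ _ => Ioo_subset_Ioo (by linarith) (by linarith)
  refine ⟨δ', hδ'pos, hδ'le, fun m m' hmm' => ?_, fun l hl => ?_⟩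
  · -- ### wall differences
    have hne : r m' ≠ r m := fun h => (ne_of_lt hmm').symm (hrinj h)
    set pr : {pr : Fin n × Fin n // pr.1 ≠ pr.2} := ⟨(r m', r m), hne⟩ with hpr
    have hreal : ∀ σ ∈ B', (∀ i, σ i ≠ 0) → (ζ (r m') σ - ζ (r m) σ).im = 0 := fun σ hσ _ => by
      rw [Complex.sub_im, im_eq_zero_of_perm_eq hτ (hrfix m') (hB'B hσ),
        im_eq_zero_of_perm_eq hτ (hrfix m) (hB'B hσ), sub_zero]
    have hpos : ∀ σ ∈ Set.pi Set.univ (fun _ : Fin d => Ioo (0 : ℝ) 1), 0 < (ζ (r m') σ - ζ (r m) σ).re :=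
      fun σ hσ => by rw [Complex.sub_re]; exact sub_pos.2 (hmono σ hσ hmm')
    have h := re_pos_on_box_of_monomial_mul hδ'pos ((hua pr).mono (hB'sub pr))
      (fun σ hσ => hu0 pr σ (hB'sub pr hσ)) (fun σ hσ => hfu pr σ (hB'sub pr hσ)) hreal hpos
    refine ⟨β pr, fun σ => (u pr σ).re, fun σ hσ => (Complex.reCLM.analyticAt _).comp (hua pr σ (hB'sub pr hσ)),
      fun σ hσ => (h σ hσ).2, fun σ hσ => ?_⟩
    have hmonom : (∏ i, ((σ i : ℝ) : ℂ) ^ β pr i) = ((∏ i, σ i ^ β pr i : ℝ) : ℂ) := by push_cast; rfl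
    have := congrArg Complex.re (hfu pr σ (hB'sub pr hσ))
    rwa [Complex.sub_re, hmonom, Complex.re_ofReal_mul] at this
  · -- ### imaginary parts
    set pr : {pr : Fin n × Fin n // pr.1 ≠ pr.2} := ⟨(l, τ l), Ne.symm hl⟩ with hpr
    obtain ⟨v, hva, hv0, hv⟩ := im_eq_monomial_mul_of_sub_conj hδ'pos ((hua pr).mono (hB'sub pr))
      (fun σ hσ => hu0 pr σ (hB'sub pr hσ)) (fun σ hσ => by
        rw [hτ l σ (hB'B hσ)]
        exact hfu pr σ (hB'sub pr hσ))
    exact ⟨β pr, v, hva, hv0, hv⟩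

end Literature.NumberTheory.Transcendental.JungPreparation
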